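import Mathlib.Algebra.Group.TypeTags.Finite
import Mathlib.Data.ZMod.Basic
import Mathlib.Topology.Instances.Int
import Mathlib.Topology.Algebra.Group.Basic
import Literature.AnabelianGeometry.EtaleTheta.FrobenioidCyclotomicRigidity

/-!
# A closed TOY `ThetaFrobenioid`: the universal closures of [EtTh] Prop. 5.5 / Thm. 5.6 as typed are false

Mochizuki, *The étale theta function …*, Publ. RIMS **45** (2009), §5: Prop. 5.5 (Frobenioid-theoretic
cyclotomic rigidity) PRIMS p.327 (PDF p.101), Thm. 5.6 (its category-theoreticity) p.328 (PDF p.102)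
[cite: MochizukiEtTh2009, Prop 5.5 p.327 (PDF p.101); Thm 5.6 p.328 (PDF p.102)].
abc-iut cell, block F, seat abc-iut-f-118; FROZEN FACT-LIST rows **F-0526** (`CyclotomicRigidity`),
**F-0527** (`CyclotomicRigidityPreserved`), **F-0530** (`PreservesRigidityIso`) of abc-iut-L2-t4's
`FrobenioidCyclotomicRigidity.lean`: SCHEMATA over the abstract §5 interface `ThetaFrobenioid C D` (DATA
ONLY), a free subquotient stub `ThetaSubquotientProj`, a candidate `RigidityFamily`, a free transport `aΨ`.
Plan rule R5 (a universal closure of a schema row is not a fact) is DECIDED here in the kernel: the three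
closures are FALSE, witnessed by the first CLOSED term of type `ThetaFrobenioid` in the tree (NV-L2
census: none existed), and the typed statements are nevertheless SATISFIABLE at a closed instance.

THE TOY `toy n s` (`n ≥ 1`; `s` = the section `s^⊓-gp`, a PARAMETER): `C = SingleObj (ℤ/n × ℤ/n)` over
`D = SingleObj (ℤ/n)`, base = first projection, trivial divisors/degrees (every arrow a linear
base-isomorphism; `O^×(S) = μ_M(S) = {1} × ℤ/n` for `n ∣ M`); `l = 1`, `N = n`, `(l·Δ_Θ)_E = ℤ/n` with
identity transports (every object is `(l,N)`-theta-saturated); `Π = ℤ × ℤ ↠ ℤ` (pr₁), `Π^tp_Ÿ = {0} × 2ℤ`,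
`ρ(a,b) = g₀^b`; `s^⊔-gp = s^trv = 1`; `K = ℚ`; `Θ̈ = 1`.  NOT the tempered Frobenioid of Example 3.9 —
a toy inhabitant of OUR typed interface.  `projToy` = the free stub `Aut_D(E) ≅ ℤ/n`; `rho` = the
canonical candidate family `g ↦ (1, g)`.
THIS FILE: the construction (`toy`, DEFINITION-kind), `isThetaSaturated` (every object), the
identifications `unitsEquiv`/`muTorsionEquiv`/`lDeltaModNEquiv` with `ℤ/n`, `projToy`, `rho`, the section
`sInr : g ↦ (1, g)`, and `ρ(0, 2k) ∈ H_{B_N}`.  The DECISIONS (`n = 3`) are in the proof-only companion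
`FrobenioidCyclotomicRigidityToyClosures.lean`: the universal closures of the three rows are FALSE
(`not_forall_cyclotomicRigidity`: with `s^⊓-gp = 1` no family is Kummer-determined;
`not_forall_preservesRigidityIso` / `not_forall_cyclotomicRigidityPreserved`: `Ψ = id` with the wrong
transport `aΨ = inversion`), while the typed Prop. 5.5 / Thm. 5.6 HOLD at `toy 3 sInr` / `Ψ = aΨ = id`
(`cyclotomicRigidity_toy`, `cyclotomicRigidityPreserved_refl`) — «universal-closure REFUTED / schema;
instance forms model-witnessed (toy)», i.e. assumptions at NAMED arguments only.
HONEST FRAMING: kernel statements about OUR typed interface at a toy; nothing here bears on, or takes a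
side on, [IUTchIII] Cor. 3.12 or [EtTh]; a FACT row is an assumption label; typed ≠ proved.
-/


namespace Literature.AnabelianGeometry.EtaleTheta

namespace CyclotomicRigidityToy

open CategoryTheory
open Literature.AlgebraicGeometry.Frobenioids FrobenioidCyclotomicRigidity

/-! ### The categories: one-object groupoids of `ℤ/n × ℤ/n` over `ℤ/n` -/

/-- `ℤ/n`, written multiplicatively (the toy's `Aut_D(B_N^bs)`, `O^×(S)`, `(l·Δ_Θ)_E`).
[cite: MochizukiEtTh2009, §5 p.327 (PDF p.101)] -/
abbrev Gn (n : ℕ+) : Type := Multiplicative (ZMod n)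

/-- The toy total category `C = SingleObj (ℤ/n × ℤ/n)`. [cite: MochizukiEtTh2009, §5 p.322 (PDF p.96)] -/
abbrev CC (n : ℕ+) : Type := SingleObj (Gn n × Gn n)

/-- The toy base category `D = SingleObj (ℤ/n)`. [cite: MochizukiEtTh2009, §5 p.322 (PDF p.96)] -/
abbrev DD (n : ℕ+) : Type := SingleObj (Gn n)

/-- `Aut_{SingleObj M}(S) ≃* M` for a commutative group `M` (an automorphism is its underlying element).
[cite: MochizukiEtTh2009, §5 p.331 (PDF p.105)] -/
def autEquiv {M : Type} [CommGroup M] (S : SingleObj M) : Aut S ≃* M where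
  toFun a := a.hom
  invFun m := ⟨m, m⁻¹, by simp [SingleObj.comp_as_mul, SingleObj.id_as_one],
    by simp [SingleObj.comp_as_mul, SingleObj.id_as_one]⟩
  left_inv a := by
    apply Iso.ext
    rfl
  right_inv m := rfl
  map_mul' a b := by
    show (a * b).hom = a.hom * b.hom
    rw [Aut.Aut_mul_def]
    rfl

/-- `autEquiv` reads off the underlying element. [cite: MochizukiEtTh2009, §5 p.331 (PDF p.105)] -/
theorem autEquiv_apply {M : Type} [CommGroup M] (S : SingleObj M) (a : Aut S) : autEquiv S a = a.hom := rfl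

/-- The inverse of `autEquiv` has the prescribed underlying element. [cite: MochizukiEtTh2009, §5 p.331 (PDF p.105)] -/
theorem autEquiv_symm_apply_hom {M : Type} [CommGroup M] (S : SingleObj M) (m : M) :
    ((autEquiv S).symm m).hom = m := rfl

/-! ### The pre-Frobenioid data: base = first projection, trivial divisors and degrees -/

/-- The toy `(Base, Div, deg_Fr)`: `Base = pr₁ : ℤ/n × ℤ/n → ℤ/n`, `Φ = 0`, `Div = 0`, `deg_Fr = 1`.
[cite: MochizukiFrdI2008, Def. 1.1 (iv) p.20] -/
def preToy (n : ℕ+) : PreFrobenioidData.{0} (CC n) (DD n) where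
  base := SingleObj.mapHom (Gn n × Gn n) (Gn n) (MonoidHom.fst _ _)
  Mon _ := PUnit
  pull _ := MonoidHom.id PUnit
  pull_id _ _ := rfl
  pull_comp _ _ _ := rfl
  div _ := 1
  degFr _ := 1
  div_id _ := rfl
  div_comp _ _ := rfl
  degFr_id _ := rfl
  degFr_comp _ _ := rfl

/-- `O^×(S) = {1} × ℤ/n`: an automorphism is a unit iff its first component is trivial.
[cite: MochizukiFrdI2008, Def. 1.2 (ii) p.22] -/
theorem mem_units_iff (n : ℕ+) (S : CC n) (a : Aut S) :
    a ∈ (preToy n).unitsSubgroup S ↔ a.hom.1 = 1 :=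
  ⟨fun h => h.1, fun h => ⟨h, rfl⟩⟩

/-- `O^×(S) ≃* ℤ/n`, the second component. [cite: MochizukiFrdI2008, Def. 1.2 (ii) p.22] -/
def unitsEquiv (n : ℕ+) (S : CC n) : (preToy n).unitsSubgroup S ≃* Gn n where
  toFun u := (u : Aut S).hom.2
  invFun g := ⟨(autEquiv S).symm (1, g), (mem_units_iff n S _).mpr rfl⟩
  left_inv u := by
    apply Subtype.ext
    apply Iso.ext
    show ((autEquiv S).symm (1, (u : Aut S).hom.2)).hom = (u : Aut S).hom
    rw [autEquiv_symm_apply_hom]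
    exact Prod.ext ((mem_units_iff n S _).mp u.2).symm rfl
  right_inv g := rfl
  map_mul' u v := by
    show ((u : Aut S) * (v : Aut S)).hom.2 = (u : Aut S).hom.2 * (v : Aut S).hom.2
    rw [Aut.Aut_mul_def]
    rfl

/-- The §5 Frobenioid-level extras of the toy: `O^×(S^birat) = (ℤ/n × ℤ/n) × ℚ^×`, identity unit
pull-backs, every arrow "of base-Frobenius type". [cite: MochizukiEtTh2009, §5 p.322 (PDF p.96)] -/
def tfStub (n : ℕ+) : FrobenioidTheta.TemperedFrobenioidStub.{0} (CC n) (DD n) where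
  pre := preToy n
  units_comm S := ⟨⟨fun u v => by
    apply (unitsEquiv n S).injective
    rw [map_mul, map_mul, mul_comm]⟩⟩
  biratUnits _ := (Gn n × Gn n) × ℚˣ
  unitsToBirat S := (MonoidHom.inl _ _).comp ((autEquiv S).toMonoidHom.comp (Subgroup.subtype _))
  unitsToBirat_injective S := by
    intro u v h
    apply Subtype.ext
    apply (autEquiv S).injective
    simpa using h
  unitsPull _ := MonoidHom.id _
  IsBaseFrobeniusType := ⊤

/-! ### The group-theoretic data: `Π = ℤ × ℤ`, `Π^tp_Ÿ = {0} × 2ℤ`, `ρ(a, b) = g₀^b` -/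

/-- Reduction mod `2` of the second factor of `ℤ × ℤ` (cuts out `Π^tp_Ÿ` inside `Ker(Π ↠ ℤ)`).
[cite: MochizukiEtTh2009, §5 p.332 (PDF p.106)] -/
def mod2 : Multiplicative ℤ × Multiplicative ℤ →* Multiplicative (ZMod 2) :=
  (Int.castAddHom (ZMod 2)).toMultiplicative.comp (MonoidHom.snd _ _)

/-- The generator `g₀ = 1 ∈ ℤ/n`. [cite: MochizukiEtTh2009, §5 p.331 (PDF p.105)] -/
def g0 (n : ℕ+) : Gn n := Multiplicative.ofAdd 1

/-- `ρ : ℤ × ℤ → Aut_D(B_N^bs) ≅ ℤ/n`, `(a, b) ↦ g₀^b` (a representative of `Π^tp_X ↠ Aut_D(B_N^bs)`).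
[cite: MochizukiEtTh2009, §5 p.331 (PDF p.105)] -/
def rhoToy (n : ℕ+) : Multiplicative ℤ × Multiplicative ℤ →* Aut (SingleObj.star (Gn n)) :=
  (autEquiv (SingleObj.star (Gn n))).symm.toMonoidHom.comp
    ((zpowersHom (Gn n) (g0 n)).comp (MonoidHom.snd _ _))

/-- `g₀` generates `ℤ/n`. [cite: MochizukiEtTh2009, §5 p.331 (PDF p.105)] -/
theorem zpowersHom_g0_surjective (n : ℕ+) : Function.Surjective (zpowersHom (Gn n) (g0 n)) := by
  intro g
  refine ⟨Multiplicative.ofAdd ((Multiplicative.toAdd g).val : ℤ), ?_⟩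
  rw [zpowersHom_apply, toAdd_ofAdd, zpow_natCast]
  apply Multiplicative.toAdd.injective
  rw [g0, ← ofAdd_nsmul, toAdd_ofAdd, nsmul_eq_mul, mul_one, ZMod.natCast_zmod_val]

/-- `ρ` is surjective. [cite: MochizukiEtTh2009, Def 4.1 (ii) p.313 (PDF p.87)] -/
theorem rhoToy_surjective (n : ℕ+) : Function.Surjective (rhoToy n) := by
  intro a
  obtain ⟨k, hk⟩ := zpowersHom_g0_surjective n (autEquiv _ a)
  refine ⟨(1, k), ?_⟩
  apply (autEquiv _).injective
  rw [← hk]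
  rfl

/-- `Ker(Π ↠ ℤ) = {0} × ℤ` maps ONTO `ℤ/2` under `mod2`. [cite: MochizukiEtTh2009, §5 p.332 (PDF p.106)] -/
theorem map_mod2_ker_fst :
    Subgroup.map mod2 (MonoidHom.fst (Multiplicative ℤ) (Multiplicative ℤ)).ker = ⊤ := by
  rw [eq_top_iff]
  intro y _
  refine ⟨(1, Multiplicative.ofAdd ((Multiplicative.toAdd y).val : ℤ)),
    by rw [SetLike.mem_coe, MonoidHom.mem_ker]; rfl, ?_⟩
  apply Multiplicative.toAdd.injective
  simp [mod2]

/-- "`[Π^tp_Y : Π^tp_Ÿ] = 2`" at the toy: `{0} × 2ℤ` has index `2` in `{0} × ℤ`.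
[cite: MochizukiEtTh2009, Thm 5.10 (iii) proof p.335 (PDF p.109)] -/
theorem relIndex_toy :
    (mod2.ker ⊓ (MonoidHom.fst (Multiplicative ℤ) (Multiplicative ℤ)).ker).relIndex
      (MonoidHom.fst (Multiplicative ℤ) (Multiplicative ℤ)).ker = 2 := by
  rw [Subgroup.inf_relIndex_right, Subgroup.relIndex_ker, map_mod2_ker_fst, Subgroup.card_top,
    Nat.card_eq_fintype_card, Fintype.card_multiplicative, ZMod.card]

/-! ### The toy `ThetaFrobenioid` -/

/-- **The closed TOY §5 datum** `toy n s` (module docstring): `l = 1`, `N = n`, all distinguished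
objects the unique object, `s^⊓_N = s^⊔_N = id`, `(l·Δ_Θ)_E = ℤ/n` with identity transports,
`Π = ℤ × ℤ ↠ ℤ` (first projection), `Π^tp_Ÿ = {0} × 2ℤ`, `ρ(a,b) = g₀^b`, `s^trv = 1`, `s^⊔-gp = 1`,
`s^⊓-gp = s` (PARAMETER), `K = ℚ ↪ O^×(B_N^birat)` the second factor, `Θ̈ = 1`.  A toy inhabitant of the
typed interface — NOT the tempered Frobenioid of [EtTh] Example 3.9.
[cite: MochizukiEtTh2009, §5 p.322–333 (PDF pp.96–107)] -/
def toy (n : ℕ+) (s : Aut (SingleObj.star (Gn n)) →* Aut (SingleObj.star (Gn n × Gn n))) :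
    ThetaFrobenioid.{0} (CC n) (DD n) where
  toTemperedFrobenioidStub := tfStub n
  lDelta _ := Gn n
  lDeltaMap _ := MonoidHom.id _
  l := 1
  odd_l := odd_one
  N := n
  Acirc := SingleObj.star _
  AN := SingleObj.star _
  BN := SingleObj.star _
  sCap := 𝟙 _
  sCup := 𝟙 _
  base_map_sCap := rfl
  isPreStep_sCap := ⟨rfl, IsIso.of_groupoid _⟩
  isPreStep_sCup := ⟨rfl, IsIso.of_groupoid _⟩
  PiX := Multiplicative ℤ × Multiplicative ℤ
  zquot := MonoidHom.fst _ _
  zquot_surjective := Prod.fst_surjective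
  PiYdd := mod2.ker ⊓ (MonoidHom.fst (Multiplicative ℤ) (Multiplicative ℤ)).ker
  PiYdd_le := inf_le_right
  relindex_PiYdd := relIndex_toy
  PiYdd_normal := inferInstance
  isOpen_PiYdd := isOpen_discrete _
  ρ := rhoToy n
  ρ_surjective := rhoToy_surjective n
  isOpen_ker_ρ := isOpen_discrete _
  strv := 1
  sgpCap := s
  sgpCup := 1
  K := ℚ
  constEmb := MonoidHom.inr _ _
  constEmb_injective := fun _ _ h => (Prod.ext_iff.mp h).2
  thetaFn := 1

/-! ### Elementary facts about `ℤ/n` -/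

/-- `|ℤ/n| = n`. [cite: MochizukiEtTh2009, Def 5.4 p.327 (PDF p.101)] -/
theorem card_Gn (n : ℕ+) : Nat.card (Gn n) = n := by
  rw [Nat.card_eq_fintype_card, Fintype.card_multiplicative, ZMod.card]

/-- `ℤ/n` is killed by `n`. [cite: MochizukiEtTh2009, Def 5.4 p.327 (PDF p.101)] -/
theorem pow_n_eq_one (n : ℕ+) (g : Gn n) : g ^ (n : ℕ) = 1 := by
  have h := pow_card_eq_one (x := g)
  rwa [Fintype.card_multiplicative, ZMod.card] at h

/-- The `n`-th powers of `ℤ/n` are trivial, so `(l·Δ_Θ) ⊗ ℤ/N = ℤ/n` at the toy.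
[cite: MochizukiEtTh2009, Def 5.4 p.327 (PDF p.101)] -/
theorem rangePow_eq_bot (n : ℕ+) : (powMonoidHom (n : ℕ) : Gn n →* Gn n).range = ⊥ := by
  rw [eq_bot_iff]
  rintro x ⟨y, rfl⟩
  rw [Subgroup.mem_bot, powMonoidHom_apply, pow_n_eq_one]

/-! ### Every object of the toy is `(l, N)`-theta-saturated; the canonical rigidity family -/

section Toy

variable (n : ℕ+) (s : Aut (SingleObj.star (Gn n)) →* Aut (SingleObj.star (Gn n × Gn n)))

/-- Units of the toy are killed by `n`. [cite: MochizukiEtTh2009, Def 5.4 p.327 (PDF p.101)] -/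
theorem pow_n_eq_one_of_mem_units (S : CC n) (u : Aut S) (hu : u ∈ (toy n s).units S) :
    u ^ (n : ℕ) = 1 := by
  apply (autEquiv S).injective
  rw [map_pow, map_one, autEquiv_apply, Prod.ext_iff]
  exact ⟨by rw [Prod.pow_fst, (mem_units_iff n S u).mp hu, one_pow]; rfl,
    by rw [Prod.pow_snd, pow_n_eq_one]; rfl⟩

/-- `μ_M(S) = O^×(S)` at the toy whenever `n ∣ M`. [cite: MochizukiEtTh2009, Def 5.4 p.327 (PDF p.101)] -/
theorem muTorsion_eq_units (S : CC n) {M : ℕ} (hM : (n : ℕ) ∣ M) :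
    (toy n s).muTorsion S M = (toy n s).units S := by
  apply le_antisymm ((toy n s).muTorsion_le_units S M)
  intro u hu
  rw [ThetaFrobenioid.mem_muTorsion]
  obtain ⟨k, rfl⟩ := hM
  exact ⟨hu, by rw [pow_mul, pow_n_eq_one_of_mem_units n s S u hu, one_pow]⟩

/-- `μ_M(S) ≃* ℤ/n` for `n ∣ M`. [cite: MochizukiEtTh2009, Def 5.4 p.327 (PDF p.101)] -/
def muTorsionEquiv (S : CC n) {M : ℕ} (hM : (n : ℕ) ∣ M) : (toy n s).muTorsion S M ≃* Gn n :=
  (MulEquiv.subgroupCongr (muTorsion_eq_units n s S hM)).trans (unitsEquiv n S)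

/-- `(l·Δ_Θ)_S ⊗ ℤ/N = (ℤ/n)/(ℤ/n)^n ≃* ℤ/n` at the toy. [cite: MochizukiEtTh2009, Def 5.4 p.327 (PDF p.101)] -/
def lDeltaModNEquiv (S : CC n) : (toy n s).lDeltaModN S ≃* Gn n :=
  (QuotientGroup.quotientMulEquivOfEq (rangePow_eq_bot n)).trans QuotientGroup.quotientBot

/-- `lDeltaModNEquiv` on classes. [cite: MochizukiEtTh2009, Def 5.4 p.327 (PDF p.101)] -/
theorem lDeltaModNEquiv_mk (S : CC n) (g : Gn n) :
    lDeltaModNEquiv n s S (QuotientGroup.mk g) = g := rfl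

/-- **Every object of the toy is `(l, N)`-theta-saturated** (Def. 5.4 (a): `μ_{l·N}(S) = O^×(S) ≅ ℤ/n
= ℤ/(1·n)`; (b): `|(l·Δ_Θ)_S ⊗ ℤ/N| = n = N`). [cite: MochizukiEtTh2009, Def 5.4 p.327 (PDF p.101)] -/
theorem isThetaSaturated (S : CC n) : (toy n s).IsThetaSaturated S where
  muSaturated := ⟨(muTorsionEquiv n s S ⟨1, (one_mul _).trans (mul_one _).symm⟩).trans
    (AddEquiv.toMultiplicative (ZMod.ringEquivCongr (one_mul (n : ℕ)).symm).toAddEquiv)⟩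
  card_lDeltaModN := by
    rw [Nat.card_congr (lDeltaModNEquiv n s S).toEquiv, card_Gn]
    rfl

/-- The canonical candidate rigidity family of the toy: `(l·Δ_Θ)_S ⊗ ℤ/N = ℤ/n ∋ g ↦ (1, g) ∈ μ_N(S)`.
[cite: MochizukiEtTh2009, Prop 5.5 p.327 (PDF p.101)] -/
def rho : RigidityFamily (toy n s) := fun S _ =>
  (lDeltaModNEquiv n s S).trans (muTorsionEquiv n s S (dvd_refl _)).symm

/-- The free subquotient stub at the toy: `Aut_D(E) ↠ (l·Δ_Θ)_E` is `Aut_D(E) ≅ ℤ/n` itself (pre-image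
`⊤`). [cite: MochizukiEtTh2009, §5 p.327 (PDF p.101)] -/
def projToy : ThetaSubquotientProj (toy n s) where
  pre _ := ⊤
  proj E := (autEquiv E).toMonoidHom.comp (Subgroup.subtype ⊤)
  proj_surjective E := (autEquiv E).surjective.comp (fun x => ⟨⟨x, Subgroup.mem_top x⟩, rfl⟩)

/-- `(0, 2k) ∈ Π^tp_Ÿ`. [cite: MochizukiEtTh2009, §5 p.332 (PDF p.106)] -/
theorem mem_PiYdd (k : ℤ) :
    ((1 : Multiplicative ℤ), Multiplicative.ofAdd (2 * k)) ∈ (toy n s).PiYdd := by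
  refine Subgroup.mem_inf.mpr ⟨?_, ?_⟩
  · rw [MonoidHom.mem_ker]
    apply Multiplicative.toAdd.injective
    simp [mod2, (by decide : (2 : ZMod 2) = 0)]
  · rw [MonoidHom.mem_ker]
    rfl

/-- `ρ(0, 2k) = g₀^{2k} ∈ H_{B_N} = ρ(Π^tp_Ÿ)`. [cite: MochizukiEtTh2009, §5 p.331 (PDF p.105)] -/
theorem rho2k_mem_HB (k : ℤ) : rhoToy n (1, Multiplicative.ofAdd (2 * k)) ∈ (toy n s).HB :=
  Subgroup.mem_map_of_mem _ (mem_PiYdd n s k)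

/-- At the toy `s^⊓-gp = s`. [cite: MochizukiEtTh2009, §5 p.331 (PDF p.105)] -/
theorem sgpCap_apply (h : Aut ((toy n s).base.obj (toy n s).BN)) : (toy n s).sgpCap h = s h := rfl

/-- At the toy `s^⊔-gp = 1`. [cite: MochizukiEtTh2009, §5 p.331 (PDF p.105)] -/
theorem sgpCup_apply (h : (toy n s).HB) : (toy n s).sgpCup h = 1 := rfl

/-- The "right" section `s^⊓-gp : g ↦ (1, g)`, under which the bi-Kummer difference IS the canonical
family on `H_{B_N}`. [cite: MochizukiEtTh2009, Prop 4.3 (iii) p.83] -/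
def sInr : Aut (SingleObj.star (Gn n)) →* Aut (SingleObj.star (Gn n × Gn n)) :=
  (autEquiv _).symm.toMonoidHom.comp ((MonoidHom.inr (Gn n) (Gn n)).comp (autEquiv _).toMonoidHom)

end Toy

end CyclotomicRigidityToy

end Literature.AnabelianGeometry.EtaleTheta
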